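import Summits.QuantumFields.YangMills.Theses.BalabanUVNodes
import Summits.QuantumFields.YangMills.Theorems.BalabanUVNodesN27AtReadingOfRecord13CoPHHolderN16Window

/-!
# BalabanUVNodes ∕ N27 = binder B5 AT THE RECORD, route-facing leaf — K3⁷ `Theses.BalabanUVNodes.SpineGivenEndpointR13SepCoPH` AT THE ⁗ READING OF RECORD WITH NODE N16 IN ITS
# CURRENCY OF RECORD «R-β», THE N16 SLOT PRODUCED IN THE (D)ʰ WINDOW-LINEAR ALL-TORUS CURRENCY AT GIVEN LETTERS `ℓ` — N05's CONJUNCTS AT EXPONENT `β` (pinned all-torus proper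
# sub-index) + N07's LINEAR LEAF under dag-n16-e 36ᴴ's twenty-one displayed linear-window letter clauses
# (module `…N27AtReadingOfRecord13CoPHHolderN16Window` §1 by name at `N = 2`, `Rg :=` the item's guard `θ.ZhUnity F 2 ∧ θ.SlotsNondegenerate₁₃ F 2`, through XXXVIᶜᵒᵖᴴ
# `spine_rec13CCoPHOn_iff_forall_guarded` and `hc := hP.toCore` — leaf E `…N27SpineGivenEndpointR13SepCoPHHolder`'s WINDOW twin, sibling of dag-n17-w3's EDGES twin
# `…N27SpineGivenEndpointR13SepCoPHHolderN16Edges` (p586655); a route-facing leaf, nothing may import it)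
# (cell `pub-ymgap`, HUMAN RULING D-0062 Track A; seat `pub-ymgap-dag-n22-w2` re-pointed to row N27 (W-a) «WINDOW twin» by plan g79 WORDS-2 (3) № 3; `--kind proof --supports
# stmt-QuantumFields-20544 --as helper`; COUNT-NEUTRAL)

WHAT IS KERNEL-CHECKED ([bookkeeping]; ONE theorem, 0 `def`, 0 `sorry`): `spineGivenEndpointR13SepCoPH_at_readingOfRecord₁₃CoPHOn_holder_of_window_linear : … → SpineGivenEndpointR13SepCoPH` —
THE ITEM as a term under displayed hypotheses: a Hölder LETTER `β ∈ [0, 1]`, a GIVEN letter family `ℓ : T4Family → NE3Letters₁₁` with dag-n16-e 36ᴴ's linear window letters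
`len c₁ c₁' B₁' cP C₂ B₀β inp α b' c'` and their twenty-one clauses `hlen … hc'` at `N = 2`, the content `hcontent` (node N05's `B8.Thm4Body (c₁ F) (B₁' F) (… zdGF3 (M₂ ℂ) F.L β (len F)
i.1 …)` ∧ `B8.Prop3Body (cP F) 4 F.L (C₂ F) (inp F) (B₀β F) (…)` on the pinned all-torus proper sub-index ∧ node N07's `LeafH3sup … (ℓ F).ε (b' F) (c' F) …` once per GUARDED family),
N14 ∕ N15 ∕ N18 ∕ N22 ∕ (D4) in guarded θ-form on the residual data `ne1`, `ne2` and node00-def-W1's `w1`, the K5 stubs at the guarded spine home, the spine-side representation `hx`,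
the N19′ edge reading `RatesHolderAt … β` AT `ℓ` (every binder other than the window block VERBATIM from leaf E's first theorem ∕ the Edges twin).

HONEST FRAMING.  NOT a discharge: a term of the item's type under displayed hypotheses (audit `proof.conditional`), each inhabited for no family today (K0⁷ OPEN); NE3 at exponent β
NOT PROVED; node N05's leaf bodies ([Balaban1985RegularSpaces] Thm 4 ∕ Prop 3 in the tree's dress) and node N07's `LeafH3sup` are N05's ∕ N07's obligations; the `h22` binder at the
guard WITHOUT a window clause is EMPTY-able at `θ.γ² ≥ ½` through the J-road (seat's own «WINDOW-N22-J», p584015) — displayed, not hidden; nothing of Bałaban's asserted or instantiated;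
N27 COMPOSITE, NOT discharged; K3⁷ NOT claimed; route rev 25 and the skeleton of record UNTOUCHED; counts UNMOVED (typed 28∕28 · discharged 5∕27, A 5∕28); one finite four-torus
programme at fixed `ε` — R4 closes the conditional rung `BalabanLadder.UV` only; NOT ℝ⁴, NOT infinite volume, NOT OS, NOT a mass gap, NOT Clay.  No decl below carries a cite tag.
-/

set_option autoImplicit false

namespace Summit.QuantumFields.YangMills.Theorems.BalabanUVNodesN27SpineRecord

open scoped Matrix.Norms.L2Operator

open Literature.MathematicalPhysics.QuantumFieldTheory.Balaban1983to89
open Literature.MathematicalPhysics.QuantumFieldTheory.Balaban1983to89.T4Continuum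
open T4ContinuumYM4Torus (ForSmallCouplings)
open Summit.QuantumFields.BalabanUV.T4Continuum.Spine
open YMDAG.UVSplit
open Node00 (Stage13HParams datumOfRecord₁₃CoPH IsRecordOfRecord₁₃CCoPH IsDatumOfRecord₁₃CCoPH NE3Letters₁₁ NE2Objects₁₁ ne3ConstLayerOfRecord₁₁ MatA)
open Node00.W1 (ReadingData)
open T4WeightBudget (RelWeightBound)
open T4IndicatorShell (ShellWeightBound)
open B7Prop1Explicit B7Prop2Explicit
open B7Prop3Flat (c3)
open B8LeafModelZd (ZdIdx)
open B8LeafModelZd3 (zdGF3)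
open Node00 (ne3NperOfRecord₁₁ ne3DomOfRecord₁₁)
open Summit.QuantumFields.BalabanUV.T4Continuum
open BlockAverageCurrent (curConst)
open NE3RightInverseSupLetters (frameC)
open Summit.QuantumFields.BalabanUV.T4Continuum.NE3.LeafIndexSockets (LeafH3sup)
open Summit.QuantumFields.YangMills.BalabanUVNodes.N16HolderDefs (N16HolderAt S_N16Holder)
open Summit.QuantumFields.YangMills.BalabanUVNodes.N16HolderRegime (radiusOfRecordH constOfRecordH)
open Summit.QuantumFields.YangMills.BalabanUVNodes.SpineRatesHolder (RatesHolderAt)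
open Summit.QuantumFields.YangMills.Theses.BalabanUVNodes (SpineGivenEndpointR13SepCoPH)

variable (cr₁₃ : SpineReading₁₃CoPH 2)
  (w1 : (F : T4Family) → (θ : Stage13HParams F 2) → Node00.W1.ReadingData F (Node00.MatA 2) θ.τ9.M)
  (ne2 : (F : T4Family) → Stage13HParams F 2 → (ℕ → ℝ) → List (ULoop F) → ℕ → NE2Objects₁₁)
  (ne1 : (F : T4Family) → Stage13HParams F 2 → (ℕ → ℝ) → List (ULoop F) → NE1pCarriers)
  (ℓ : T4Family → NE3Letters₁₁)
  {len : T4Family → Site 4 → ℝ} {c₁ c₁' B₁' cP C₂ B₀β : T4Family → ℝ} {inp : T4Family → B8.B9Inputs} {α b' c' : T4Family → ℝ}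

/-- ★★ **K3⁷ AT THE ⁗ READING OF RECORD WITH NODE N16 IN ITS CURRENCY OF RECORD R-β, THE N16 SLOT PRODUCED IN THE (D)ʰ WINDOW-LINEAR ALL-TORUS CURRENCY AT GIVEN LETTERS `ℓ`**
(`N = 2`; leaf A §4 ∕ XXXVIᶜᵒᵖᴴ `spine_rec13CCoPHOn_iff_forall_guarded` ∘ (W-a) `spine_rec13CCoPHOn_at_readingOfRecord₁₃CoPH_holder_of_window_linear` at `Rg :=` the item's guard,
`hc := hP.toCore`): leaf E's WINDOW twin — dag-n16-e 36ᴴ §2's inputs at exponent `β ∈ [0, 1]` (a LETTER; the consumers' window `2∕3 < β < 1` lies inside): the linear window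
letters and their twenty-one clauses `hlen … hc'`, the content `hcontent` (node N05's `B8.Thm4Body` ∕ `B8.Prop3Body` at exponent `β` on the pinned all-torus proper sub-index ∧ node
N07's `LeafH3sup` at `((ℓ F).ε, b′ F, c′ F)`, once per guarded family), N14 ∕ N15 ∕ N18 ∕ N22 ∕ (D4) in guarded θ-form, the K5 stubs at the guarded spine home, the spine-side
representation `hx`, the N19′ edge reading `RatesHolderAt … β` AT `ℓ` — the guard reaching each.  NOT a discharge: a term of the item's type under displayed hypotheses, each inhabited
for no family today (K0⁷ OPEN); NE3 at exponent β NOT PROVED; N05 ∕ N07 ∕ N16 ∕ N27 NOT discharged. [bookkeeping] -/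
theorem spineGivenEndpointR13SepCoPH_at_readingOfRecord₁₃CoPHOn_holder_of_window_linear
    {β : ℝ} (hβ0 : 0 ≤ β) (hβ1 : β ≤ 1)
    (hlen : ∀ (F : T4Family) (v : Site 4), 0 < len F v → 1 ≤ len F v) (hlen1 : ∀ (F : T4Family) (μ : Fin 4), len F (e μ) = 1)
    (hB₁' : ∀ F, 0 < B₁' F) (hBB : ∀ F : T4Family, 5 * ((4 : ℕ) : ℝ) * F.L * (inp F).B₀ ≤ B₁' F) (hc₁' : ∀ F, 0 < c₁' F)
    (hwin : ∀ (F : T4Family) (α₀ α₁ : ℝ), 0 < α₀ → 0 < α₁ → α₀ + α₁ ≤ c₁' F →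
      α₀ + α₁ ≤ c₁ F ∧ C0 4 * (2 * α₀) ≤ 1 / 3 ∧ 4 * α₀ ≤ c2' 4 F.L ∧ 16 * (B₁' F * (α₀ + α₁)) ≤ 1 ∧
      Real.exp (4 * (800 * (((4 : ℕ) : ℝ) + 1) ^ 2 * (((4 : ℕ) : ℝ) + 4)) * α₀) * (1 + 8 * (131072 * (((4 : ℕ) : ℝ) + 1) ^ 2) * (B₁' F * (α₀ + α₁))) ≤ 2 ∧
      2 * (B₁' F * (α₀ + α₁)) ≤ c3 4 F.L ∧ ((4 : ℕ) : ℝ) * F.L * α₁ ≤ 1 / 8 ∧ α₀ ≤ cP F ∧ α₁ ≤ cP F ∧ B₁' F * (α₀ + α₁) ≤ cP F ∧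
      2 * (B₁' F * (α₀ + α₁)) ^ 2 + 20 * ((4 : ℕ) : ℝ) * α₀ * (B₁' F * (α₀ + α₁)) + 2 * C₂ F * (B₁' F * (α₀ + α₁)) ^ 2 ≤ α₀ + α₁)
    (hα : ∀ F, 0 < α F) (hα1 : ∀ F, α F ≤ c₁' F / 177)
    (hα2 : ∀ F : T4Family, α F ≤ (ℓ F).Λ₁ / (1770 * (5 * ((4 : ℕ) : ℝ) * F.L * (inp F).B₀) + 1))
    (hα3 : ∀ F : T4Family, α F ≤ c2' 4 F.L / 2)
    (hα4 : ∀ F : T4Family, α F ≤ 1 / ((23040 * (4 : ℝ) ^ 4 * (frameC 4 F.L + 4) ^ 3 + 12) * (1 + curConst 4 F.L) + 1))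
    (hα5 : ∀ F, α F ≤ 1 / 10 ^ 9)
    (hg : ∀ F, 0 < (ℓ F).g) (hε0 : ∀ F, 0 < (ℓ F).ε) (hε : ∀ F, (ℓ F).ε < α F)
    (hΛ₁r : ∀ F : T4Family, (ℓ F).Λ₁ ≤ radiusOfRecordH 2 F.L (ne3NperOfRecord₁₁ F 0 0))
    (hb : ∀ F, 0 ≤ (ℓ F).b ∧ (ℓ F).b ≤ (ℓ F).ε / 2) (hC : ∀ F : T4Family, constOfRecordH 2 F.L (ne3NperOfRecord₁₁ F 0 0) (ℓ F).g ≤ (ℓ F).C)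
    (hΛ₂' : ∀ F : T4Family, 177 * α F * (5 * ((4 : ℕ) : ℝ) * F.L * B₀β F + 5 * ((4 : ℕ) : ℝ) * F.L * (inp F).B₀) ≤ (ℓ F).Λ₂')
    (hb' : ∀ F, 0 ≤ b' F ∧ b' F ≤ α F / 2048) (hc' : ∀ F, 0 ≤ c' F ∧ c' F ≤ α F / 24)
    (hcontent : ∀ (F : T4Family), (∃ θ : Stage13HParams F 2, θ.Provisos₁₃CoPH F 2 ∧ (θ.ZhUnity F 2 ∧ θ.SlotsNondegenerate₁₃ F 2) ∧ θ.Admissible F 2) →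
      letI : CStarAlgebra (Matrix (Fin 2) (Fin 2) ℂ) := {}
      B8.Thm4Body (c₁ F) (B₁' F) (fun i : {i : ZdIdx 4 F.L // (∀ j, i.Ω j = Set.univ) ∧ (∀ m j, i.Λs m j = {_y | j = m}) ∧ (∀ m j, i.Λb m j = {_c | j = m}) ∧ i.η = ((F.L : ℝ)⁻¹) ^ i.k} => (zdGF3 (Matrix (Fin 2) (Fin 2) ℂ) F.L β (len F) i.1).toGFData) ∧
        B8.Prop3Body (cP F) 4 (F.L : ℝ) (C₂ F) (inp F) (B₀β F)
          (fun i : {i : ZdIdx 4 F.L // (∀ j, i.Ω j = Set.univ) ∧ (∀ m j, i.Λs m j = {_y | j = m}) ∧ (∀ m j, i.Λb m j = {_c | j = m}) ∧ i.η = ((F.L : ℝ)⁻¹) ^ i.k} => (zdGF3 (Matrix (Fin 2) (Fin 2) ℂ) F.L β (len F) i.1).toGFData2) ∧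
        LeafH3sup 4 F.L (ne3NperOfRecord₁₁ F 0 0) (ℓ F).ε (b' F) (c' F) (ne3DomOfRecord₁₁ F 2 0 0))
    (h14 : ∀ (F : T4Family) (θ : Stage13HParams F 2), θ.Provisos₁₃CoPH F 2 → (θ.ZhUnity F 2 ∧ θ.SlotsNondegenerate₁₃ F 2) → θ.Admissible F 2 → ∀ (g₀ : ℕ → ℝ) (os : List (ULoop F)),
      N14At (ne1 F θ g₀ os))
    (h15 : ∀ (F : T4Family) (θ : Stage13HParams F 2), θ.Provisos₁₃CoPH F 2 → (θ.ZhUnity F 2 ∧ θ.SlotsNondegenerate₁₃ F 2) → θ.Admissible F 2 → ∀ (g₀ : ℕ → ℝ) (os : List (ULoop F)) (k : ℕ),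
      N15At (ne2OfRecord₁₁ (ne2 F θ g₀ os k)))
    (h18 : ∀ (F : T4Family) (θ : Stage13HParams F 2), θ.Provisos₁₃CoPH F 2 → (θ.ZhUnity F 2 ∧ θ.SlotsNondegenerate₁₃ F 2) → θ.Admissible F 2 → ∀ k : ℕ,
      N18At (u3OfRecord₁₃ θ.toStage13Params ((w1 F θ).u3Objects θ.γ) k))
    (h22 : ∀ (F : T4Family) (θ : Stage13HParams F 2), θ.Provisos₁₃CoPH F 2 → (θ.ZhUnity F 2 ∧ θ.SlotsNondegenerate₁₃ F 2) → θ.Admissible F 2 → ∀ k : ℕ,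
      N22At (u3OfRecord₁₃ θ.toStage13Params ((w1 F θ).u3Objects θ.γ) k))
    (hD4 : ∀ (F : T4Family) (θ : Stage13HParams F 2) (hP : θ.Provisos₁₃CoPH F 2), (θ.ZhUnity F 2 ∧ θ.SlotsNondegenerate₁₃ F 2) → θ.Admissible F 2 → ∀ k : ℕ,
      ReadOutAt (datumOfRecord₁₃CoPH F 2 θ hP) (u3OfRecord₁₃ θ.toStage13Params ((w1 F θ).u3Objects θ.γ) k))
    (h20 : S_N20 (SRec₁₃CoPHOn cr₁₃ fun F θ => θ.ZhUnity F 2 ∧ θ.SlotsNondegenerate₁₃ F 2)) (h21 : S_N21 (SRec₁₃CoPHOn cr₁₃ fun F θ => θ.ZhUnity F 2 ∧ θ.SlotsNondegenerate₁₃ F 2))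
    (hx : ∀ (F : T4Family) (θ : Stage13HParams F 2) (hP : θ.Provisos₁₃CoPH F 2), (θ.ZhUnity F 2 ∧ θ.SlotsNondegenerate₁₃ F 2) → θ.Admissible F 2 →
      B16.EndStatementBPrinted (datumOfRecord₁₃CoPH F 2 θ hP).C → DagBinding.EndpointExistence (datumOfRecord₁₃CoPH F 2 θ hP).C.toB12 →
        ForSmallCouplings (datumOfRecord₁₃CoPH F 2 θ hP) fun g₀ => ∀ os : List (ULoop F),
          0 < (cr₁₃ F θ hP g₀ os).l₀ ∧ 0 < (cr₁₃ F θ hP g₀ os).vol ∧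
          (∀ (K : ℕ) (t : ℝ), |t| ≤ (cr₁₃ F θ hP g₀ os).l₀ →
            T4GenFunBounds.schemeZ ((datumOfRecord₁₃CoPH F 2 θ hP).scheme g₀) os ((cr₁₃ F θ hP g₀ os).K₀ + K) t =
              ∑ τ ∈ (cr₁₃ F θ hP g₀ os).T K, (cr₁₃ F θ hP g₀ os).A K t τ) ∧
          (∀ (K : ℕ) (t : ℝ), |t| ≤ (cr₁₃ F θ hP g₀ os).l₀ →
            T4GenFunBounds.schemeZ ((datumOfRecord₁₃CoPH F 2 θ hP).scheme g₀) os ((cr₁₃ F θ hP g₀ os).K₀ + K + 1) t =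
              ∑ τ ∈ (cr₁₃ F θ hP g₀ os).T K, (cr₁₃ F θ hP g₀ os).B K t τ))
    (h19 : ∀ (F : T4Family) (θ : Stage13HParams F 2) (hP : θ.Provisos₁₃CoPH F 2), (θ.ZhUnity F 2 ∧ θ.SlotsNondegenerate₁₃ F 2) → θ.Admissible F 2 → ∀ (g₀ : ℕ → ℝ) (os : List (ULoop F)),
      (∀ k : ℕ, RatesHolderAt (datumOfRecord₁₃CoPH F 2 θ hP) (rateCarriersOfRecord₁₃CoPH (readingOfRecord₁₃CoPH w1 ℓ ne2 ne1) F θ hP g₀ os k) β) → letI := (cr₁₃ F θ hP g₀ os).dec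
        ∃ δ : ℕ → ℝ, NE7.Core (cr₁₃ F θ hP g₀ os).l₀ (cr₁₃ F θ hP g₀ os).vol (cr₁₃ F θ hP g₀ os).T (cr₁₃ F θ hP g₀ os).Bad
          (fun K t τ => (cr₁₃ F θ hP g₀ os).A K t τ - (cr₁₃ F θ hP g₀ os).shA K t τ) (fun K t τ => (cr₁₃ F θ hP g₀ os).B K t τ - (cr₁₃ F θ hP g₀ os).shB K t τ) δ ∧
          Summable δ) :
    SpineGivenEndpointR13SepCoPH :=
  fun F θ hP hG hθ _ _ =>
    (spine_rec13CCoPHOn_iff_forall_guarded fun F θ => θ.ZhUnity F 2 ∧ θ.SlotsNondegenerate₁₃ F 2).mp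
      (spine_rec13CCoPHOn_at_readingOfRecord₁₃CoPH_holder_of_window_linear (cr := cr₁₃) (w1 := w1) (ne2 := ne2) (ne1 := ne1)
        (Rg := fun F θ => θ.ZhUnity F 2 ∧ θ.SlotsNondegenerate₁₃ F 2) (ℓ := ℓ) hβ0 hβ1 hlen hlen1 hB₁' hBB hc₁' hwin hα hα1 hα2 hα3 hα4 hα5 hg hε0 hε hΛ₁r hb hC
        hΛ₂' hb' hc' hcontent h14 h15 h18 h22 hD4 h20 h21 hx h19) F θ hP.toCore hG hθ

end Summit.QuantumFields.YangMills.Theorems.BalabanUVNodesN27SpineRecord
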